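import Mathlib
import Summits.NavierStokesRegularity.NavierStokesRegularity.Theorems.EulerZoomLiouvillePowerGaugeEulerLiouvilleSelfSimilarSwirlRatchetSlow
import Summits.NavierStokesRegularity.NavierStokesRegularity.Theorems.EulerZoomLiouvillePowerGaugeEulerLiouvilleSelfSimilarSwirlRatchetLocal
import HarnessLib

/-!
# Crux E `PowerGaugeEulerLiouville` (stmt-NavierStokesRegularity-19832), THE ONE STATEMENT: the SLOW-INFLOW swirl stratum with hypotheses ON THE SWIRL SET ONLY
# (width seat ns-ezl-w3 g3)

Route №10 `EulerZoomLiouville` (NavierStokesRegularity), crux E; LEAD ns-typeII-p2 g12.  In `IsTameSwirl ρ V` the bounded-swirl and bounded-`ℋ` alternatives ask for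
linear growth only on the swirl set `{rV_θ ≠ 0}` ((L) p644521), but the SLOW-INFLOW alternative ((C2) p641286 `hasNoSwirl_of_slowInflow`) still asks for GLOBAL linear
growth and a GLOBAL inflow bound `⟪z, γz + V z⟫ ≥ −(c₁‖z‖² + D)`.  Both are used only along the backward similarity orbit from a swirl point, which never leaves the
swirl set (ratchet `Γ(Y t) = e^{(1−2γ)t}Γ(y)`, global orbit from `exists_backward_orbit_of_swirlGrowth`).  Hence:

* `norm_sq_backward_orbit_le_of_orbit` — the one-sided Grönwall bound `‖Y t‖² ≤ gronwallBound ‖Y 0‖² (2c₁) (2D) t` with the inflow bound assumed ONLY ALONG THE ORBIT;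
* `hasNoSwirl_of_slowInflow_local` — `(U, P)` a `C²` self-similar profile, `U` axisymmetric, `γ < ½`, with, ON THE SWIRL SET ONLY, linear growth `‖U z‖ ≤ K₁(1+‖z‖)` and
  the inflow bound `⟪z, γz + U z⟫ ≥ −(c₁‖z‖² + D)` (`0 < c₁`, `2c₁ < 1 − 2γ`) ⇒ swirl-free;
* member `selfSimilar_ae_eq_zero_of_axisym_slowInflow_C2_local` and past twin `…_local_past` (binders of the (C2) members VERBATIM with `hlin`, `hslow` restricted to
  `swirl V z ≠ 0 → …`).

For the LEAD: the slow-inflow alternative of `IsTameSwirl` may move into the «growth on the swirl set» group, with the inflow bound also asked only on the swirl set.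
WHAT THIS IS NOT: not NS regularity, not the crux E — a widening of one axisymmetric stratum of the crux CLASS 19832 (MODEL lattice; E/NS strata) `--supports` stmt-19832;
19832 OPEN. [cite: Chae2007CMPEuler, Thm 2.2 + Note added p. 6]
-/

noncomputable section

-- flat `Theorems/<Route><Decl>…` files of one crux share the namespace of the crux (tree convention: `Summit.<S>.<S>.…`)
set_option linter.dupNamespace false

open MeasureTheory Set Filter Topology Metric Function InnerProductSpace
open scoped RealInnerProductSpace NNReal ContDiff

namespace Summit.NavierStokesRegularity.NavierStokesRegularity.Theorems.PowerGaugeEulerLiouville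

open Literature.Analysis Literature.Analysis.FluidPDE Literature.Analysis.FunctionSpaces

namespace SwirlRatchet

variable {γ : ℝ} {U : EuclideanSpace ℝ (Fin 3) → EuclideanSpace ℝ (Fin 3)} {P : EuclideanSpace ℝ (Fin 3) → ℝ}

/-- **One-sided Grönwall for a backward orbit, inflow bound along the orbit only**: `Y' = −W(Y)` on `[0, ∞)` and `⟪Y s, W (Y s)⟫ ≥ −(c₁‖Y s‖² + D)` for `s ≥ 0`
give `‖Y t‖² ≤ gronwallBound ‖Y 0‖² (2c₁) (2D) t`. [folklore] -/
theorem norm_sq_backward_orbit_le_of_orbit {W : EuclideanSpace ℝ (Fin 3) → EuclideanSpace ℝ (Fin 3)}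
    {Y : ℝ → EuclideanSpace ℝ (Fin 3)} (hY : ∀ t, 0 ≤ t → HasDerivWithinAt Y (-(W (Y t))) (Ici 0) t)
    {c₁ D : ℝ} (hslow : ∀ s, 0 ≤ s → -(c₁ * ‖Y s‖ ^ 2 + D) ≤ ⟪Y s, W (Y s)⟫) {t : ℝ} (ht : 0 ≤ t) :
    ‖Y t‖ ^ 2 ≤ gronwallBound (‖Y 0‖ ^ 2) (2 * c₁) (2 * D) t := by
  set f : ℝ → ℝ := fun s => ‖Y s‖ ^ 2 with hf
  have hder : ∀ s, 0 ≤ s → HasDerivWithinAt f (2 * ⟪Y s, -(W (Y s))⟫) (Ici s) s :=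
    fun s hs => ((hY s hs).mono (Ici_subset_Ici.2 hs)).norm_sq
  have hcont : ContinuousOn f (Icc 0 t) := fun s hs => ((hY s hs.1).norm_sq.continuousWithinAt).mono fun r hr => hr.1
  have hf' : ∀ s ∈ Ico 0 t, ∀ r, 2 * ⟪Y s, -(W (Y s))⟫ < r → ∃ᶠ z in 𝓝[>] s, (z - s)⁻¹ * (f z - f s) < r := by
    intro s hs r hr
    refine ((hder s hs.1).liminf_right_slope_le hr).mono fun z hz => ?_
    rwa [slope_def_field, div_eq_inv_mul] at hz
  have hbound : ∀ s ∈ Ico 0 t, 2 * ⟪Y s, -(W (Y s))⟫ ≤ 2 * c₁ * f s + 2 * D := by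
    intro s hs
    rw [inner_neg_right]
    have := hslow s hs.1
    simp only [hf]
    linarith
  have h := le_gronwallBound_of_liminf_deriv_right_le hcont hf' (le_of_eq rfl) hbound t (right_mem_Icc.2 ht)
  rwa [sub_zero] at h

/-- **SLOW INFLOW ON THE SWIRL SET ⇒ NO SWIRL**: `(U, P)` a `C²` self-similar Euler profile, `U` axisymmetric, and ON THE SWIRL SET `{Γ ≠ 0}` linear growth
`‖U z‖ ≤ K₁(1+‖z‖)` and the inflow bound `⟪z, γz + U z⟫ ≥ −(c₁‖z‖² + D)` with `0 < c₁`, `2c₁ < 1 − 2γ`.  (The backward orbit from a swirl point stays in the swirl set;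
`|Γ(y)|e^{(1−2γ)t} = |Γ(Y t)| ≤ ‖Y t‖‖U(Y t)‖ ≤ C e^{2c₁t}`.) [cite: Chae2007CMPEuler, Thm 2.2 + Note added p. 6] -/
theorem hasNoSwirl_of_slowInflow_local (h : IsSelfSimilarEulerProfile γ 0 U P) (hU : IsAxisymmetric U)
    {K₁ : ℝ} (hlin : ∀ z, swirl U z ≠ 0 → ‖U z‖ ≤ K₁ * (1 + ‖z‖)) {c₁ D : ℝ} (hc₁ : 0 < c₁) (hgap : 2 * c₁ < 1 - 2 * γ)
    (hslow : ∀ z, swirl U z ≠ 0 → -(c₁ * ‖z‖ ^ 2 + D) ≤ ⟪z, selfSimilarTransport γ 0 U z⟫) : HasNoSwirl U := by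
  intro y
  by_contra hne
  have hK₁ : 0 ≤ K₁ := by
    have h0 := hlin y hne
    by_contra hneg
    push Not at hneg
    have : K₁ * (1 + ‖y‖) < 0 := mul_neg_of_neg_of_pos hneg (by positivity)
    linarith [norm_nonneg (U y)]
  -- the global backward orbit from `y` (it stays in the swirl set)
  obtain ⟨Y, hY0, hY, -⟩ := exists_backward_orbit_of_swirlGrowth h hU hlin hne
  have hratchet : ∀ t, 0 ≤ t → swirl U (Y t) = swirl U y * Real.exp ((1 - 2 * γ) * t) := by
    intro t ht
    rw [← hY0]
    exact swirl_backward_orbit h hU hY ht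
  have hsw : ∀ t, 0 ≤ t → swirl U (Y t) ≠ 0 := fun t ht => by
    rw [hratchet t ht]; exact mul_ne_zero hne (Real.exp_pos _).ne'
  -- size of the orbit
  set M₀ : ℝ := ‖y‖ ^ 2 + |D| / c₁ with hM₀
  have hM₀0 : 0 ≤ M₀ := by rw [hM₀]; positivity
  have horbit : ∀ t, 0 ≤ t → ‖Y t‖ ^ 2 ≤ M₀ * Real.exp (2 * c₁ * t) := by
    intro t ht
    have hslow' : ∀ s, 0 ≤ s → -(c₁ * ‖Y s‖ ^ 2 + |D|) ≤ ⟪Y s, selfSimilarTransport γ 0 U (Y s)⟫ := fun s hs =>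
      le_trans (by linarith [le_abs_self D]) (hslow (Y s) (hsw s hs))
    have h1 := norm_sq_backward_orbit_le_of_orbit hY hslow' ht
    rw [hY0] at h1
    refine h1.trans ?_
    have h2 := gronwallBound_le_mul_exp (δ := ‖y‖ ^ 2) (t := t) (by positivity : 0 < 2 * c₁) (by positivity : 0 ≤ 2 * |D|)
    have h3 : ‖y‖ ^ 2 + 2 * |D| / (2 * c₁) = M₀ := by rw [hM₀]; field_simp
    rwa [h3] at h2
  set C : ℝ := K₁ * (1 + 2 * M₀) with hC
  have hswirl : ∀ t, 0 ≤ t → |swirl U (Y t)| ≤ C * Real.exp (2 * c₁ * t) := by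
    intro t ht
    have hx : 0 ≤ ‖Y t‖ := norm_nonneg _
    have he : 1 ≤ Real.exp (2 * c₁ * t) := Real.one_le_exp (by positivity)
    calc |swirl U (Y t)| ≤ ‖Y t‖ * ‖U (Y t)‖ := by
          rw [swirl_eq_inner_rotGen]
          exact (abs_real_inner_le_norm _ _).trans
            (mul_le_mul_of_nonneg_right (PineauVicol2026.norm_rotGen_le (Y t)) (norm_nonneg _))
      _ ≤ ‖Y t‖ * (K₁ * (1 + ‖Y t‖)) := mul_le_mul_of_nonneg_left (hlin _ (hsw t ht)) hx
      _ = K₁ * (‖Y t‖ + ‖Y t‖ ^ 2) := by ring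
      _ ≤ K₁ * (1 + 2 * ‖Y t‖ ^ 2) := by
          apply mul_le_mul_of_nonneg_left _ hK₁; nlinarith [sq_nonneg (‖Y t‖ - 1)]
      _ ≤ K₁ * (1 + 2 * (M₀ * Real.exp (2 * c₁ * t))) := by gcongr; exact horbit t ht
      _ ≤ C * Real.exp (2 * c₁ * t) := by rw [hC]; nlinarith [mul_nonneg hK₁ hM₀0]
  -- the race between the ratchet `e^{(1−2γ)t}` and the escape `e^{2c₁t}`
  have hpos : 0 < |swirl U y| := abs_pos.2 hne
  set δ : ℝ := (1 - 2 * γ) - 2 * c₁ with hδ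
  have hδ0 : 0 < δ := by rw [hδ]; linarith
  have hC0 : 0 ≤ C := by rw [hC]; positivity
  set t : ℝ := (C / |swirl U y| + 1) / δ with htdef
  have ht0 : 0 ≤ t := by rw [htdef]; positivity
  have hexp : C / |swirl U y| + 1 < Real.exp (δ * t) := by
    have h1 : δ * t = C / |swirl U y| + 1 := by rw [htdef]; field_simp
    rw [h1]
    linarith [Real.add_one_le_exp (C / |swirl U y| + 1)]
  have hkey : |swirl U y| * Real.exp ((1 - 2 * γ) * t) ≤ C * Real.exp (2 * c₁ * t) := by
    have h1 := hswirl t ht0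
    rwa [hratchet t ht0, abs_mul, abs_of_pos (Real.exp_pos _)] at h1
  have hsplit : Real.exp ((1 - 2 * γ) * t) = Real.exp (δ * t) * Real.exp (2 * c₁ * t) := by
    rw [← Real.exp_add]; congr 1; rw [hδ]; ring
  rw [hsplit, ← mul_assoc] at hkey
  have hkey' : |swirl U y| * Real.exp (δ * t) ≤ C := le_of_mul_le_mul_right hkey (Real.exp_pos _)
  have : C < |swirl U y| * Real.exp (δ * t) := by
    have h2 : C < |swirl U y| * (C / |swirl U y| + 1) := by
      rw [mul_add, mul_div_cancel₀ _ hpos.ne', mul_one]; linarith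
    exact h2.trans (mul_lt_mul_of_pos_left hexp hpos)
  linarith

end SwirlRatchet

/-! ### Member forms -/

namespace SwirlRatchet

variable {u : ℝ → EuclideanSpace ℝ (Fin 3) → EuclideanSpace ℝ (Fin 3)} {p : ℝ → EuclideanSpace ℝ (Fin 3) → ℝ}
  {H : ℝ → EuclideanSpace ℝ (Fin 3) → EuclideanSpace ℝ (Fin 3) →L[ℝ] EuclideanSpace ℝ (Fin 3)} {c : ℝ≥0}
  {V : EuclideanSpace ℝ (Fin 3) → EuclideanSpace ℝ (Fin 3)} {P : EuclideanSpace ℝ (Fin 3) → ℝ}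

/-- **MEMBER FORM: AXISYMMETRIC `C²` PROFILE, SLOW INFLOW AND LINEAR GROWTH ON THE SWIRL SET ⇒ TRIVIAL** — binders of `selfSimilar_ae_eq_zero_of_axisym_slowInflow_C2`
verbatim with `hlin` and `hslow` restricted to `swirl V z ≠ 0 → …`. [cite: Chae2007CMPEuler, Thm 2.2 + Note added p. 6] -/
theorem selfSimilar_ae_eq_zero_of_axisym_slowInflow_C2_local {ρ : ℝ} (hρ : 0 < ρ) (hρ1 : ρ ≤ 1 / 2)
    (hsw : IsSuitableWeakSolutionOn (slab (EuclideanSpace ℝ (Fin 3)) (Iio 0) isOpen_Iio) 0 0 u p)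
    (hH : HasWeakSpatialGradientOn (slab (EuclideanSpace ℝ (Fin 3)) (Iio 0) isOpen_Iio) u H)
    (hgauge : ∀ a : ℝ, 0 < a →
      ENNReal.ofReal (a ^ (2 * ρ)) * cknA a (0 : ℝ × EuclideanSpace ℝ (Fin 3)) u +
          ENNReal.ofReal (a ^ ρ) * cknE a (0 : ℝ × EuclideanSpace ℝ (Fin 3)) H +
        ENNReal.ofReal (a ^ (2 * ρ)) * cknD a (0 : ℝ × EuclideanSpace ℝ (Fin 3)) p ≤ (c : ENNReal))
    (hu : ∀ τ : ℝ, τ < 0 → u τ = selfSimilarCollapse (1 / (2 + ρ)) 0 V τ)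
    (hp : ∀ τ : ℝ, τ < 0 → p τ = selfSimilarCollapsePressure (1 / (2 + ρ)) 0 P τ)
    (hV : ContDiff ℝ 2 V) (hax : IsAxisymmetric V)
    (hlin : ∃ K₁ : ℝ, ∀ y, swirl V y ≠ 0 → ‖V y‖ ≤ K₁ * (1 + ‖y‖))
    (hslow : ∃ c₁ D : ℝ, 0 < c₁ ∧ 2 * c₁ < ρ / (2 + ρ) ∧
      ∀ z : EuclideanSpace ℝ (Fin 3), swirl V z ≠ 0 → -(c₁ * ‖z‖ ^ 2 + D) ≤ ⟪z, selfSimilarTransport (1 / (2 + ρ)) 0 V z⟫) :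
    uncurry u =ᵐ[volume.restrict (Iio (0 : ℝ) ×ˢ (univ : Set (EuclideanSpace ℝ (Fin 3))))] 0 := by
  obtain ⟨K₁, hK₁⟩ := hlin
  obtain ⟨c₁, D, hc₁, hgap, hsl⟩ := hslow
  have hρ1' : ρ < 1 := by linarith
  rw [← one_sub_two_mul_exponent hρ] at hgap
  have hD : ∀ a : ℝ, 0 < a → ENNReal.ofReal (a ^ (2 * ρ)) *
      cknD a (0 : ℝ × EuclideanSpace ℝ (Fin 3)) p ≤ (c : ENNReal) :=
    fun a ha => le_trans le_add_self (hgauge a ha)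
  have hpm : AEStronglyMeasurable (uncurry p)
      (volume.restrict (Iio (0 : ℝ) ×ˢ (univ : Set (EuclideanSpace ℝ (Fin 3))))) := by
    have := hsw.distributional.2.2.1.aestronglyMeasurable
    simpa [slab] using this
  have hPm := aestronglyMeasurable_pressureProfile hpm hp
  have hDprof := profile_pressure_weight_of_gaugeD hρ hρ1' hpm hp hD
  have hP1 : LocallyIntegrable P volume :=
    EnergySaturation.locallyIntegrable_pressure_of_weight hρ1' hPm
      (ENNReal.mul_ne_top ENNReal.ofReal_ne_top ENNReal.coe_ne_top) hDprof
  obtain ⟨P', hprof⟩ := WeakToClassical.exists_isSelfSimilarEulerProfile_of_contDiff hsw.distributional hu hp hV hP1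
  have hns : HasNoSwirl V := hasNoSwirl_of_slowInflow_local hprof hax hK₁ hc₁ hgap hsl
  exact NeedleRace.selfSimilar_ae_eq_zero_of_axisymNoSwirlC2 hρ hρ1 hsw hH hgauge hu hp hV hax hns

/-- **PAST TWIN of `selfSimilar_ae_eq_zero_of_axisym_slowInflow_C2_local`** (velocity and pressure exactly self-similar about `(T, x₀)` for `τ < T₁`, `T₁ ≤ 0`, `T₁ ≤ T`).
[cite: Chae2007CMPEuler, Thm 2.2 + Note added p. 6] -/
theorem selfSimilar_ae_eq_zero_of_axisym_slowInflow_C2_local_past {ρ T T₁ : ℝ} (hρ : 0 < ρ) (hρ1 : ρ ≤ 1 / 2)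
    (hT₁ : T₁ ≤ 0) (hTT₁ : T₁ ≤ T) (x₀ : EuclideanSpace ℝ (Fin 3))
    (hsw : IsSuitableWeakSolutionOn (slab (EuclideanSpace ℝ (Fin 3)) (Iio 0) isOpen_Iio) 0 0 u p)
    (hH : HasWeakSpatialGradientOn (slab (EuclideanSpace ℝ (Fin 3)) (Iio 0) isOpen_Iio) u H)
    (hgauge : ∀ a : ℝ, 0 < a →
      ENNReal.ofReal (a ^ (2 * ρ)) * cknA a (0 : ℝ × EuclideanSpace ℝ (Fin 3)) u +
          ENNReal.ofReal (a ^ ρ) * cknE a (0 : ℝ × EuclideanSpace ℝ (Fin 3)) H +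
        ENNReal.ofReal (a ^ (2 * ρ)) * cknD a (0 : ℝ × EuclideanSpace ℝ (Fin 3)) p ≤ (c : ENNReal))
    (hu : ∀ τ : ℝ, τ < T₁ → u τ = fun x => selfSimilarCollapse (1 / (2 + ρ)) T V τ (x - x₀))
    (hp : ∀ τ : ℝ, τ < T₁ → p τ = fun x => selfSimilarCollapsePressure (1 / (2 + ρ)) T P τ (x - x₀))
    (hV : ContDiff ℝ 2 V) (hax : IsAxisymmetric V)
    (hlin : ∃ K₁ : ℝ, ∀ y, swirl V y ≠ 0 → ‖V y‖ ≤ K₁ * (1 + ‖y‖))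
    (hslow : ∃ c₁ D : ℝ, 0 < c₁ ∧ 2 * c₁ < ρ / (2 + ρ) ∧
      ∀ z : EuclideanSpace ℝ (Fin 3), swirl V z ≠ 0 → -(c₁ * ‖z‖ ^ 2 + D) ≤ ⟪z, selfSimilarTransport (1 / (2 + ρ)) 0 V z⟫) :
    uncurry u =ᵐ[volume.restrict (Iio (0 : ℝ) ×ˢ (univ : Set (EuclideanSpace ℝ (Fin 3))))] 0 := by
  obtain ⟨K₁, hK₁⟩ := hlin
  obtain ⟨c₁, D, hc₁, hgap, hsl⟩ := hslow
  rw [← one_sub_two_mul_exponent hρ] at hgap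
  obtain ⟨P', hprof⟩ := Past.exists_isSelfSimilarEulerProfile hρ hT₁ hTT₁ hsw.distributional hu hp hV
  have hns : HasNoSwirl V := hasNoSwirl_of_slowInflow_local hprof hax hK₁ hc₁ hgap hsl
  exact NeedleRace.selfSimilar_ae_eq_zero_of_axisymNoSwirlC2_past hρ hρ1 hT₁ hTT₁ x₀ hsw hH hgauge hu hp hV hax hns

end SwirlRatchet

end Summit.NavierStokesRegularity.NavierStokesRegularity.Theorems.PowerGaugeEulerLiouville

end
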